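import Literature.Analysis.FluidPDE.LocalEnergyInitialLEI
import Literature.Analysis.FluidPDE.LocalLerayInitialSliceLEI
import HarnessLib

/-!
# Local Leray solutions on a slab: the local energy inequality **from the initial time** for
  space–time test functions (Lemarié-Rieusset 2016, (14.11); Seregin 2014, Remark B.3, (B.1.10))

Analysis/FluidPDE theorem file (no new definitions, no named facts) over the finite-slab class
`IsLocalLeraySolutionOn T ν v₀ v π` (`LocalLeraySolutionsSlab.lean`: Kang–Miura–Tsai 2021,
Def. 3.2 on `(0,T)` = Lemarié-Rieusset 2016, Def. 14.1), written for the proof of the named fact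
`Literature.Analysis.FluidPDE.jia_sverak_2014_local_higher_regularity`
(`JiaSverak2014LocalRegularity.lean`; H. Jia, V. Šverák, Invent. Math. 196 (2014) =
arXiv:1204.0529, §4): there the Leray solution is continued to negative times by its (locally
smooth) datum, and the continued field has to be a *suitable* weak solution of a forced
Navier–Stokes system on a space–time region containing the initial slice `t = 0`. Across that
slice the local energy inequality of the continued field is the sum of the steady energy identity
of the datum (for `t < 0`) and of the local energy inequality of the Leray solution **from the
initial time, tested with a space–time test function `φ(t, x) ≥ 0` that need not vanish at
`t = 0`**:

  `2ν ∫∫_{(0,T)×ℝ³} |G|² φ ≤ ∫ |v₀|² φ(0) dx + ∫∫_{(0,T)×ℝ³} (|v|²(φₜ + νΔφ) + (|v|² + 2π) v·∇φ)`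

(Lemarié-Rieusset 2016, (14.11), p. 498, in the proof of Prop. 14.1; Seregin 2014, App. B,
Remark B.3, (B.1.10) with `t₀ = 0`: "valid [...] for a.a. `t₀ ∈ [0,T]`, including `t₀ = 0`").
The tree proves exactly this statement for Seregin's class of local *energy* solutions
(`IsLocalEnergySolutionOn.localEnergyIneq_initial`, `LocalEnergyInitialLEI.lean`), whose slices
are measurable and locally square integrable **at every time**; and, for the slab local Leray
class, the *sliced* form with a time-independent weight
(`IsLocalLeraySolutionOn.ae_localEnergyIneq_initial_slice`, `LocalLerayInitialSliceLEI.lean`).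
This file records the space–time form for the slab local Leray class itself:

* `IsLocalLeraySolutionOn.integrableOn_localEnergyRHS_slab` — the right-hand integrand
  `R[φ] = |v|²(φₜ + νΔφ) + (|v|² + 2π) v·∇φ` is integrable on `(0,T) × ℝ³` up to `t = 0`;
* `IsLocalLeraySolutionOn.exists_ae_abs_integral_sq_mul_sub_datum_le` — the weighted energy of
  the slices tends to that of the datum, `|∫ |v(t)|² φ(t) − ∫ |v₀|² φ(0)| ≤ ε` for a.e. small `t`;
* `IsLocalLeraySolutionOn.localEnergyIneq_initial` — the inequality displayed above, for every
  weak spatial gradient `G` of `v` on the slab and every measurable datum `v₀`.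

The proofs are the tree's (cut-offs `η_δ(t) φ(t,x)`, `δ → 0` through the initial condition,
Robinson–Rodrigo–Sadowski 2016, §3.1), verbatim except that the every-time local `L²` bound and
slice measurability of Seregin's class are replaced by their almost-every-time counterparts,
which is all the argument uses (clause (2) of the class, `uniformLocalEnergy`, and
`ae_slice_aestronglyMeasurable_and_lintegral_ball_lt_top`).

## Mathlib / tree search

Tree (all used): `IsLocalEnergySolutionOn.localEnergyIneq_initial` and its helpers
`integrableOn_frobeniusNormSq_mul_slab`, `localEnergyRHS_mul_of_hasDerivAt`,
`exists_smooth_time_cutoff`, `tendsto_setIntegral_mul_of_ae_tendsto`,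
`exists_abs_le_of_eq_zero_off_Ioo`, `lintegral_datum_sq_lt_top`,
`BradshawTsai2019.exists_ae_abs_integral_sq_mul_sub_le`, `IsSpaceTimeTestOn.cutoff`
(`LocalEnergyInitialLEI`, `LocalEnergySliceLEI`, `DistributionalToWeak`, `LocalLerayInitialEnergy`);
the slab-class integrability `IsLocalLeraySolutionOn.integrableOn_velocity/pressure/
cubicFlux_cylinder` (`LocalLeraySlabCubicIntegrability`, `LocalLerayInitialSliceLEI`).
Mathlib: `tendsto_integral_of_dominated_convergence`, `integral_prod`,
`le_of_tendsto_of_tendsto'`.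

## References

* P. G. Lemarié-Rieusset, *The Navier–Stokes Problem in the 21st Century*, CRC Press (2016),
  doi:10.1201/b19556: (14.11) and Prop. 14.1 (p. 498); Def. 14.1. [LemarieRieusset2016]
* G. Seregin, *Lecture Notes on Regularity Theory for the Navier–Stokes Equations*, World
  Scientific (2014), App. B, Remark B.3, (B.1.10). [Seregin2014Notes]
* J. C. Robinson, J. L. Rodrigo, W. Sadowski, *The Three-Dimensional Navier–Stokes Equations*
  (CUP 2016), §3.1 (the cut-off argument producing the initial term).
* H. Jia, V. Šverák, Invent. Math. 196 (2014) = arXiv:1204.0529, §3–§4. [JiaSverak2014]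
-/

noncomputable section

open MeasureTheory TopologicalSpace Set Function Filter Metric
open _root_.Topology
open scoped ENNReal NNReal RealInnerProductSpace Laplacian

namespace Literature.Analysis.FluidPDE

namespace IsLocalLeraySolutionOn

variable {T ν : ℝ} {v₀ : EuclideanSpace ℝ (Fin 3) → EuclideanSpace ℝ (Fin 3)}
  {v : ℝ → EuclideanSpace ℝ (Fin 3) → EuclideanSpace ℝ (Fin 3)}
  {π : ℝ → EuclideanSpace ℝ (Fin 3) → ℝ}

/-! ## Integrability of the local energy integrand up to the initial time -/

/-- **The right-hand integrand of the local energy inequality is integrable on the slab up to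
the initial time.** For a local Leray solution on `(0, T) × ℝ³` and a smooth compactly
supported space–time function `φ` (on all of `ℝ × ℝ³`), `R[φ] = |v|²(φₜ + νΔφ) + (|v|² + 2π) v·∇φ`
is integrable on `(0, T) × ℝ³` (the tree's proof for Seregin's class, verbatim: the slab-class
integrability of `|v|²` and of the cubic flux on finite cylinders). [folklore] -/
theorem integrableOn_localEnergyRHS_slab (h : IsLocalLeraySolutionOn T ν v₀ v π)
    {φ : ℝ → EuclideanSpace ℝ (Fin 3) → ℝ}
    (hφ : IsSpaceTimeTestOn (⊤ : Opens (ℝ × EuclideanSpace ℝ (Fin 3))) φ) :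
    IntegrableOn (localEnergyRHS ν 0 v π φ) (Ioo 0 T ×ˢ (univ : Set (EuclideanSpace ℝ (Fin 3))))
      volume := by
  -- the compact `x`-shadow `K` of `φ`
  obtain ⟨K₀, hK₀, hK₀t⟩ := hφ.exists_compact_slice_subset
  obtain ⟨ρ, hρ⟩ := hK₀.isBounded.subset_closedBall (0 : EuclideanSpace ℝ (Fin 3))
  set K : Set (EuclideanSpace ℝ (Fin 3)) := closedBall 0 ρ with hKdef
  have hK : IsCompact K := isCompact_closedBall _ _
  have hKt : ∀ t, tsupport (φ t) ⊆ K := fun t => (hK₀t t).trans hρ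
  have hφ0 : ∀ t x, x ∉ K → φ t x = 0 := fun t x hx =>
    image_eq_zero_of_notMem_tsupport fun h' => hx (hKt t h')
  have hT0 : ∀ t x, x ∉ K → timeDeriv φ t x = 0 := fun t x hx =>
    timeDeriv_eq_zero_of_forall (fun s => hφ0 s x hx) t
  have hD0 : ∀ t x, x ∉ K → gradient (φ t) x = 0 := fun t x hx => by
    have : fderiv ℝ (φ t) x = 0 := fderiv_of_notMem_tsupport ℝ fun h' => hx (hKt t h')
    simp [gradient, this]
  have hL0 : ∀ t x, x ∉ K → Δ (φ t) x = 0 := fun t x hx =>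
    laplacian_eq_zero_of_notMem_tsupport fun h' => hx (hKt t h')
  -- continuity and boundedness of the coefficient fields
  have cT : Continuous fun z : ℝ × EuclideanSpace ℝ (Fin 3) => timeDeriv φ z.1 z.2 :=
    hφ.continuous_timeDeriv
  have cL : Continuous fun z : ℝ × EuclideanSpace ℝ (Fin 3) => Δ (φ z.1) z.2 :=
    hφ.laplacian_top.contDiff.continuous
  obtain ⟨cg, hcg, -⟩ := hφ.continuous_gradient_field
  have hT' : IsSpaceTimeTestOn (⊤ : Opens (ℝ × EuclideanSpace ℝ (Fin 3))) (timeDeriv φ) :=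
    hφ.timeDeriv_top
  obtain ⟨C₁, hC₁⟩ := cT.bounded_above_of_compact_support hT'.hasCompactSupport
  obtain ⟨C₂, hC₂⟩ := cL.bounded_above_of_compact_support hφ.laplacian_top.hasCompactSupport
  obtain ⟨C₃, hC₃⟩ := cg.bounded_above_of_compact_support hcg
  -- reduce to the finite cylinder `(0,T) × K`
  have hvan : ∀ z ∈ Ioo (0 : ℝ) T ×ˢ (univ : Set (EuclideanSpace ℝ (Fin 3))) \ Ioo 0 T ×ˢ K,
      localEnergyRHS ν 0 v π φ z = 0 := by
    intro z hz
    have hx : z.2 ∉ K := fun hxK => hz.2 ⟨hz.1.1, hxK⟩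
    simp only [localEnergyRHS, hT0 z.1 z.2 hx, hL0 z.1 z.2 hx, hD0 z.1 z.2 hx, hφ0 z.1 z.2 hx,
      Pi.zero_apply, inner_zero_right, inner_zero_left]
    ring
  refine IntegrableOn.of_forall_sdiff_eq_zero ?_ (measurableSet_Ioo.prod MeasurableSet.univ) hvan
  -- integrability on the cylinder: domination by `M (|v|² + (5/3)|v|³ + (4/3)|π|^{3/2})`
  obtain ⟨hu, hu2⟩ := h.integrableOn_velocity hK
  have hp := h.integrableOn_pressure hK
  have hflux := h.integrableOn_cubicFlux_cylinder hK
  have hm : AEStronglyMeasurable (localEnergyRHS ν 0 v π φ) (volume.restrict (Ioo 0 T ×ˢ K)) := by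
    have e : localEnergyRHS ν 0 v π φ = fun z : ℝ × EuclideanSpace ℝ (Fin 3) =>
        ‖uncurry v z‖ ^ 2 * (timeDeriv φ z.1 z.2 + ν * Δ (φ z.1) z.2) +
          ⟪(‖v z.1 z.2‖ ^ 2 + 2 * π z.1 z.2) • v z.1 z.2, gradient (φ z.1) z.2⟫ +
          2 * ⟪(0 : ℝ → EuclideanSpace ℝ (Fin 3) → EuclideanSpace ℝ (Fin 3)) z.1 z.2,
            uncurry v z⟫ * φ z.1 z.2 := by
      funext z
      simp only [localEnergyRHS, real_inner_smul_left, uncurry]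
    rw [e]
    refine ((((hu.aestronglyMeasurable.norm.pow 2).mul
      ((cT.add (continuous_const.mul cL)).aestronglyMeasurable)).add
      (hflux.aestronglyMeasurable.inner cg.aestronglyMeasurable)).add ?_)
    have : (fun z : ℝ × EuclideanSpace ℝ (Fin 3) =>
        2 * ⟪(0 : ℝ → EuclideanSpace ℝ (Fin 3) → EuclideanSpace ℝ (Fin 3)) z.1 z.2,
          uncurry v z⟫ * φ z.1 z.2) = fun _ => 0 := by
      funext z; simp
    rw [this]
    exact aestronglyMeasurable_const
  set M : ℝ := (C₁ + |ν| * C₂) + C₃ with hM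
  refine Integrable.mono' ((hu2.const_mul (C₁ + |ν| * C₂)).add (hflux.norm.const_mul C₃)) hm
    (Eventually.of_forall fun z => ?_)
  have h1 : ‖timeDeriv φ z.1 z.2 + ν * Δ (φ z.1) z.2‖ ≤ C₁ + |ν| * C₂ := by
    refine (norm_add_le _ _).trans (add_le_add (hC₁ z) ?_)
    rw [norm_mul, Real.norm_eq_abs]
    exact mul_le_mul_of_nonneg_left (hC₂ z) (abs_nonneg ν)
  have h2 : ‖⟪(‖v z.1 z.2‖ ^ 2 + 2 * π z.1 z.2) • v z.1 z.2, gradient (φ z.1) z.2⟫‖ ≤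
      C₃ * ‖(‖v z.1 z.2‖ ^ 2 + 2 * π z.1 z.2) • v z.1 z.2‖ := by
    refine (norm_inner_le_norm _ _).trans ?_
    rw [mul_comm]
    exact mul_le_mul_of_nonneg_right (hC₃ z) (norm_nonneg _)
  simp only [localEnergyRHS, Pi.zero_apply, inner_zero_left, mul_zero, zero_mul, add_zero,
    Pi.add_apply]
  have e3 : (‖v z.1 z.2‖ ^ 2 + 2 * π z.1 z.2) * ⟪v z.1 z.2, gradient (φ z.1) z.2⟫ =
      ⟪(‖v z.1 z.2‖ ^ 2 + 2 * π z.1 z.2) • v z.1 z.2, gradient (φ z.1) z.2⟫ := by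
    rw [real_inner_smul_left]
  rw [e3]
  refine (norm_add_le _ _).trans (add_le_add ?_ h2)
  rw [norm_mul]
  have : ‖‖v z.1 z.2‖ ^ 2‖ = ‖uncurry v z‖ ^ 2 := by
    rw [Real.norm_eq_abs, abs_of_nonneg (sq_nonneg _)]; rfl
  rw [this, mul_comm]
  exact mul_le_mul_of_nonneg_right h1 (sq_nonneg _)

/-! ## The weighted energy near the initial time -/

/-- **The weighted energy of the slices tends to that of the datum, with a time-dependent
weight.** For a local Leray solution on `(0, T) × ℝ³` with measurable datum `v₀` and a smooth
compactly supported space–time `φ`: for every `ε > 0` there is `τ > 0` such that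
`|∫ |v(t)|² φ(t) − ∫ |v₀|² φ(0)| ≤ ε` for a.e. `t ∈ (0, τ)` (frozen weight by
`BradshawTsai2019.exists_ae_abs_integral_sq_mul_sub_le` and clause (3); unfreezing by the uniform
continuity of `φ` in time and the a.e.-time local `L²` bound of clause (2)). [folklore] -/
theorem exists_ae_abs_integral_sq_mul_sub_datum_le (h : IsLocalLeraySolutionOn T ν v₀ v π)
    (hT : 0 < T) (hm₀ : AEStronglyMeasurable v₀ volume)
    {φ : ℝ → EuclideanSpace ℝ (Fin 3) → ℝ}
    (hφ : IsSpaceTimeTestOn (⊤ : Opens (ℝ × EuclideanSpace ℝ (Fin 3))) φ)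
    (hφ0 : ∀ t x, 0 ≤ φ t x) {ε : ℝ} (hε : 0 < ε) :
    ∃ τ > 0, ∀ᵐ t ∂((volume : Measure ℝ).restrict (Ioo 0 τ)),
      |(∫ x, ‖v t x‖ ^ 2 * φ t x) - ∫ x, ‖v₀ x‖ ^ 2 * φ 0 x| ≤ ε := by
  -- the compact `x`-shadow
  obtain ⟨K₀, hK₀, hK₀t⟩ := hφ.exists_compact_slice_subset
  obtain ⟨ρ', hρ'⟩ := hK₀.isBounded.subset_closedBall (0 : EuclideanSpace ℝ (Fin 3))
  -- a nonnegative radius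
  set ρ : ℝ := max ρ' 0 with hρdef
  have hρ0 : 0 ≤ ρ := le_max_right _ _
  have hρ : K₀ ⊆ closedBall (0 : EuclideanSpace ℝ (Fin 3)) ρ :=
    hρ'.trans (closedBall_subset_closedBall (le_max_left _ _))
  set K : Set (EuclideanSpace ℝ (Fin 3)) := closedBall 0 ρ with hKdef
  have hK : IsCompact K := isCompact_closedBall _ _
  have hφK : ∀ t x, x ∉ K → φ t x = 0 := fun t x hx =>
    image_eq_zero_of_notMem_tsupport fun h' => hx (hρ (hK₀t t h'))
  obtain ⟨Cφ, hCφ⟩ := hφ.contDiff.continuous.bounded_above_of_compact_support hφ.hasCompactSupport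
  have hCφ' : ∀ t x, φ t x ≤ Cφ := fun t x => (le_abs_self _).trans (by
    have := hCφ (t, x); rwa [Real.norm_eq_abs] at this)
  -- (i) frozen weight `φ 0`
  have hslices := ae_slice_aestronglyMeasurable_and_lintegral_ball_lt_top h.aestronglyMeasurable
    h.sqIntegrable
  have hgood : ∀ᵐ t ∂((volume : Measure ℝ).restrict (Ioo 0 T)),
      AEStronglyMeasurable (v t) volume ∧ ∫⁻ x in K, ‖v t x‖ₑ ^ 2 < ∞ := by
    filter_upwards [hslices] with t ht
    refine ⟨ht.1, lt_of_le_of_lt ?_ (ht.2 ⌈ρ⌉₊)⟩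
    exact lintegral_mono_set (closedBall_subset_closedBall (Nat.le_ceil ρ))
  have hu₀ : ∫⁻ x in K, ‖v₀ x‖ₑ ^ 2 < ∞ := lintegral_datum_sq_lt_top hT hgood hm₀ (h.initial K hK)
  obtain ⟨τ₁, hτ₁, hae₁⟩ := BradshawTsai2019.exists_ae_abs_integral_sq_mul_sub_le hT hK hgood hm₀
    hu₀ (h.initial K hK) (hφ.contDiff_slice 0).continuous (fun x => hφ0 0 x) (fun x => hCφ' 0 x)
    (fun x hx => hφK 0 x hx) (half_pos hε)
  -- (ii) unfreezing: uniform continuity in time against the a.e.-time bound on `B(0, ρ+1)`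
  obtain ⟨C, hC⟩ := h.uniformLocalEnergy (ρ + 1) (by linarith)
  have hCpos : 0 < (C : ℝ) + 1 := by positivity
  set η : ℝ := ε / 2 / ((C : ℝ) + 1) with hη
  have hη0 : 0 < η := by positivity
  have huc : UniformContinuous (uncurry φ) :=
    hφ.hasCompactSupport.uniformContinuous_of_continuous hφ.contDiff.continuous
  obtain ⟨δ, hδ, hδφ⟩ := Metric.uniformContinuous_iff.1 huc η hη0
  -- the final `τ`
  set τ : ℝ := min (min τ₁ δ) T with hτ
  have hτ0 : 0 < τ := lt_min (lt_min hτ₁ hδ) hT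
  refine ⟨τ, hτ0, ?_⟩
  have hae₁' : ∀ᵐ t ∂((volume : Measure ℝ).restrict (Ioo 0 τ)),
      |(∫ x, ‖v t x‖ ^ 2 * φ 0 x) - ∫ x, ‖v₀ x‖ ^ 2 * φ 0 x| ≤ ε / 2 :=
    ae_restrict_of_ae_restrict_of_subset
      (Ioo_subset_Ioo_right ((min_le_left _ _).trans (min_le_left _ _))) hae₁
  have hτT : Ioo (0 : ℝ) τ ⊆ Ioo 0 T := Ioo_subset_Ioo_right (min_le_right _ _)
  have hC' := ae_restrict_of_ae_restrict_of_subset hτT hC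
  have hgood' := ae_restrict_of_ae_restrict_of_subset hτT hgood
  filter_upwards [hae₁', ae_restrict_mem measurableSet_Ioo, hC', hgood'] with t ht1 htI hCt hgt
  have htδ : |t| < δ := by
    rw [abs_of_pos htI.1]
    exact htI.2.trans_le ((min_le_left _ _).trans (min_le_right _ _))
  -- pointwise bound on the weights
  have hw : ∀ x, |φ t x - φ 0 x| ≤ η := fun x => by
    have hd : dist ((t, x) : ℝ × EuclideanSpace ℝ (Fin 3)) (0, x) < δ := by
      rw [Prod.dist_eq, dist_self, max_eq_left dist_nonneg, Real.dist_eq, sub_zero]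
      exact htδ
    have := hδφ hd
    rw [Real.dist_eq] at this
    exact this.le
  -- the unfreezing estimate `|∫ |v t|² (φ t − φ 0)| ≤ η C`
  have hφB : ∀ s x, x ∉ ball (0 : EuclideanSpace ℝ (Fin 3)) (ρ + 1) → φ s x = 0 := fun s x hx =>
    hφK s x fun hxK => hx (closedBall_subset_ball (by linarith) hxK)
  -- the slice is square integrable on the ball `B(0, ρ + 1)`
  have hsqB : Integrable (fun x => ‖v t x‖ ^ 2) (volume.restrict (ball 0 (ρ + 1))) := by
    refine ⟨(hgt.1.norm.pow 2).restrict, ?_⟩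
    rw [hasFiniteIntegral_iff_enorm]
    refine lt_of_le_of_lt (lintegral_mono fun x => le_of_eq ?_) ((hCt 0).trans_lt ENNReal.coe_lt_top)
    rw [Real.enorm_eq_ofReal (sq_nonneg _), ← ofReal_norm, ENNReal.ofReal_pow (norm_nonneg _)]
  have hik_s : ∀ s, Integrable (fun x => ‖v t x‖ ^ 2 * φ s x) volume := by
    intro s
    have hon : IntegrableOn (fun x => ‖v t x‖ ^ 2 * φ s x) (ball 0 (ρ + 1)) volume :=
      hsqB.mul_bdd (hφ.contDiff_slice s).continuous.aestronglyMeasurable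
        (Eventually.of_forall fun x => hCφ (s, x))
    refine (integrableOn_iff_integrable_of_support_subset (μ := volume) ?_).1 hon
    intro x hx
    by_contra hxB
    exact hx (show ‖v t x‖ ^ 2 * φ s x = 0 by rw [hφB s x hxB, mul_zero])
  have hik : Integrable (fun x => ‖v t x‖ ^ 2 * φ t x) volume := hik_s t
  have hik0 : Integrable (fun x => ‖v t x‖ ^ 2 * φ 0 x) volume := hik_s 0
  have hsqB_le : ∫ x in ball 0 (ρ + 1), ‖v t x‖ ^ 2 ≤ C := by
    have e1 : ∫ x in ball 0 (ρ + 1), ‖v t x‖ ^ 2 =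
        (∫⁻ x in ball 0 (ρ + 1), ENNReal.ofReal (‖v t x‖ ^ 2)).toReal :=
      integral_eq_lintegral_of_nonneg_ae (Eventually.of_forall fun x => by positivity)
        hsqB.aestronglyMeasurable
    have e2 : ∫⁻ x in ball 0 (ρ + 1), ENNReal.ofReal (‖v t x‖ ^ 2) =
        ∫⁻ x in ball 0 (ρ + 1), ‖v t x‖ₑ ^ 2 := by
      refine lintegral_congr fun x => ?_
      rw [← ofReal_norm, ENNReal.ofReal_pow (norm_nonneg _)]
    rw [e1, e2]
    calc (∫⁻ x in ball 0 (ρ + 1), ‖v t x‖ₑ ^ 2).toReal ≤ ((C : ℝ≥0∞)).toReal :=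
          ENNReal.toReal_mono ENNReal.coe_ne_top (hCt 0)
      _ = C := ENNReal.coe_toReal C
  have hdiff : |(∫ x, ‖v t x‖ ^ 2 * φ t x) - ∫ x, ‖v t x‖ ^ 2 * φ 0 x| ≤ η * C := by
    rw [← integral_sub hik hik0]
    have e1 : (fun x => ‖v t x‖ ^ 2 * φ t x - ‖v t x‖ ^ 2 * φ 0 x) =
        fun x => ‖v t x‖ ^ 2 * (φ t x - φ 0 x) := by
      funext x; ring
    rw [e1]
    have e2 : ∫ x, ‖v t x‖ ^ 2 * (φ t x - φ 0 x) =
        ∫ x in ball 0 (ρ + 1), ‖v t x‖ ^ 2 * (φ t x - φ 0 x) := by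
      refine (setIntegral_eq_integral_of_forall_compl_eq_zero fun x hx => ?_).symm
      rw [hφB t x hx, hφB 0 x hx, sub_zero, mul_zero]
    rw [e2]
    have hint : Integrable (fun x => ‖v t x‖ ^ 2 * (φ t x - φ 0 x))
        (volume.restrict (ball 0 (ρ + 1))) :=
      hsqB.mul_bdd ((((hφ.contDiff_slice t).continuous).sub
        ((hφ.contDiff_slice 0).continuous)).aestronglyMeasurable)
        (Eventually.of_forall fun x => by rw [Real.norm_eq_abs]; exact hw x)
    calc |∫ x in ball 0 (ρ + 1), ‖v t x‖ ^ 2 * (φ t x - φ 0 x)|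
        ≤ ∫ x in ball 0 (ρ + 1), |‖v t x‖ ^ 2 * (φ t x - φ 0 x)| := by
          rw [← Real.norm_eq_abs]
          exact (norm_integral_le_integral_norm _).trans_eq
            (integral_congr_ae (Eventually.of_forall fun x => Real.norm_eq_abs _))
      _ ≤ ∫ x in ball 0 (ρ + 1), ‖v t x‖ ^ 2 * η := by
          refine integral_mono hint.abs (hsqB.mul_const η) fun x => ?_
          rw [abs_mul, abs_of_nonneg (by positivity : (0 : ℝ) ≤ ‖v t x‖ ^ 2)]
          exact mul_le_mul_of_nonneg_left (hw x) (by positivity)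
      _ = η * ∫ x in ball 0 (ρ + 1), ‖v t x‖ ^ 2 := by rw [integral_mul_const, mul_comm]
      _ ≤ η * C := mul_le_mul_of_nonneg_left hsqB_le hη0.le
  have hηC : η * C ≤ ε / 2 := by
    have e1 : η * (C : ℝ) ≤ η * ((C : ℝ) + 1) := mul_le_mul_of_nonneg_left (by linarith) hη0.le
    have e2 : η * ((C : ℝ) + 1) = ε / 2 := by rw [hη]; field_simp
    linarith
  have habs := abs_le.1 (hdiff.trans hηC)
  have habs1 := abs_le.1 ht1
  rw [abs_le]
  constructor <;> linarith [habs.1, habs.2, habs1.1, habs1.2]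


/-! ## The local energy inequality from the initial time -/

/-- **The local energy inequality of a local Leray solution on a slab from the initial time,
for space–time test functions** (Lemarié-Rieusset 2016, (14.11), p. 498; Seregin 2014, App. B,
Remark B.3, (B.1.10) with `t₀ = 0`: "valid [...] for a.a. `t₀ ∈ [0,T]`, including `t₀ = 0`").
Let `(v, π)` be a local Leray solution on `(0, T) × ℝ³`, `T > 0`, with measurable datum `v₀`,
let `G` be a weak spatial gradient of `v` on the open slab, and let `φ ≥ 0` be a space–time test
function on `(-∞, T) × ℝ³` (so `φ(0, ·)` need not vanish). Then
`2ν ∫∫_{(0,T)×ℝ³} |G|² φ ≤ ∫ |v₀|² φ(0) dx + ∫∫_{(0,T)×ℝ³} (|v|²(φₜ + νΔφ) + (|v|² + 2π) v·∇φ)`.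
Proof: the tree's proof for Seregin's class (cut-offs `η_δ φ`, `δ → 0`), verbatim.
[cite: LemarieRieusset2016, (14.11) p. 498 (proof of Prop. 14.1)] -/
theorem localEnergyIneq_initial (h : IsLocalLeraySolutionOn T ν v₀ v π) (hT : 0 < T)
    (hm₀ : AEStronglyMeasurable v₀ volume)
    {G : ℝ → EuclideanSpace ℝ (Fin 3) → EuclideanSpace ℝ (Fin 3) →L[ℝ] EuclideanSpace ℝ (Fin 3)}
    (hG : HasWeakSpatialGradientOn (slab (EuclideanSpace ℝ (Fin 3)) (Ioo 0 T) isOpen_Ioo) v G)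
    {φ : ℝ → EuclideanSpace ℝ (Fin 3) → ℝ}
    (hφ : IsSpaceTimeTestOn (slab (EuclideanSpace ℝ (Fin 3)) (Iio T) isOpen_Iio) φ)
    (hφ0 : ∀ t x, 0 ≤ φ t x) :
    2 * ν * ∫ z in Ioo 0 T ×ˢ (univ : Set (EuclideanSpace ℝ (Fin 3))),
        frobeniusNormSq (G z.1 z.2) * φ z.1 z.2 ≤
      (∫ x, ‖v₀ x‖ ^ 2 * φ 0 x) +
        ∫ z in Ioo 0 T ×ˢ (univ : Set (EuclideanSpace ℝ (Fin 3))), localEnergyRHS ν 0 v π φ z := by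
  -- ## the slab, the support of `φ`
  set Q : Opens (ℝ × EuclideanSpace ℝ (Fin 3)) :=
    slab (EuclideanSpace ℝ (Fin 3)) (Ioo 0 T) isOpen_Ioo with hQ
  set S : Set (ℝ × EuclideanSpace ℝ (Fin 3)) :=
    Ioo 0 T ×ˢ (univ : Set (EuclideanSpace ℝ (Fin 3))) with hS
  have hQS : (Q : Set (ℝ × EuclideanSpace ℝ (Fin 3))) = S := rfl
  have hSm : MeasurableSet S := measurableSet_Ioo.prod MeasurableSet.univ
  have hmemS : ∀ z : ℝ × EuclideanSpace ℝ (Fin 3), z ∈ S ↔ z.1 ∈ Ioo 0 T := fun z => by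
    simp [hS]
  have hφ' : IsSpaceTimeTestOn (⊤ : Opens (ℝ × EuclideanSpace ℝ (Fin 3))) φ := hφ.mono le_top
  -- `φ` and its derivatives vanish for `t ≥ T`
  have hφT : ∀ z : ℝ × EuclideanSpace ℝ (Fin 3), T ≤ z.1 → z ∉ tsupport (uncurry φ) :=
    fun z hz hmem => absurd (mem_slab.1 (hφ.tsupport_subset hmem)) (not_lt.2 hz)
  have hR_T : ∀ z : ℝ × EuclideanSpace ℝ (Fin 3), T ≤ z.1 → localEnergyRHS ν 0 v π φ z = 0 := by
    intro z hz
    have hnot := hφT z hz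
    have h1 : timeDeriv φ z.1 z.2 = 0 := IsSpaceTimeTestOn.timeDeriv_eq_zero_of_notMem hnot
    have h2 : gradient (φ z.1) z.2 = 0 := by
      simp [gradient, IsSpaceTimeTestOn.fderiv_slice_eq_zero_of_notMem hnot]
    have h3 : Δ (φ z.1) z.2 = 0 :=
      laplacian_eq_zero_of_notMem_tsupport (notMem_tsupport_slice hnot)
    simp only [localEnergyRHS, h1, h2, h3, Pi.zero_apply, inner_zero_right, inner_zero_left,
      mul_zero, zero_mul, add_zero]
  have hφ_T : ∀ z : ℝ × EuclideanSpace ℝ (Fin 3), T ≤ z.1 → φ z.1 z.2 = 0 := fun z hz =>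
    show uncurry φ z = 0 from image_eq_zero_of_notMem_tsupport (hφT z hz)
  -- ## the integrands, integrable on `S` up to `t = 0`
  obtain ⟨G', hG', hGb⟩ := h.uniformLocalGradient
  set R : ℝ × EuclideanSpace ℝ (Fin 3) → ℝ := localEnergyRHS ν 0 v π φ with hR
  set F' : ℝ × EuclideanSpace ℝ (Fin 3) → ℝ := fun z =>
    frobeniusNormSq (G' z.1 z.2) * φ z.1 z.2 with hF'
  set W : ℝ × EuclideanSpace ℝ (Fin 3) → ℝ := fun z => ‖v z.1 z.2‖ ^ 2 * φ z.1 z.2 with hW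
  have hIR : IntegrableOn R S volume := h.integrableOn_localEnergyRHS_slab hφ'
  have hIF' : IntegrableOn F' S volume := integrableOn_frobeniusNormSq_mul_slab hG' hGb hφ'
  have hIW : IntegrableOn W S volume := by
    obtain ⟨K₀, hK₀, hK₀t⟩ := hφ.exists_compact_slice_subset
    have hφK : ∀ t x, x ∉ K₀ → φ t x = 0 := fun t x hx =>
      image_eq_zero_of_notMem_tsupport fun h' => hx (hK₀t t h')
    obtain ⟨Cφ, hCφ⟩ := hφ.contDiff.continuous.bounded_above_of_compact_support hφ.hasCompactSupport
    obtain ⟨-, hu2⟩ := h.integrableOn_velocity hK₀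
    have hvan : ∀ z ∈ S \ Ioo 0 T ×ˢ K₀, W z = 0 := by
      intro z hz
      have hx : z.2 ∉ K₀ := fun hxK => hz.2 ⟨((hmemS z).1 hz.1), hxK⟩
      simp only [hW, hφK z.1 z.2 hx, mul_zero]
    refine IntegrableOn.of_forall_sdiff_eq_zero ?_ hSm hvan
    exact hu2.mul_bdd hφ.contDiff.continuous.aestronglyMeasurable
      (Eventually.of_forall fun z => hCφ (z.1, z.2))
  -- indicator versions
  set RS := S.indicator R with hRS
  set FS := S.indicator F' with hFS
  set WS := S.indicator W with hWS
  have hIRS : Integrable RS (volume : Measure (ℝ × EuclideanSpace ℝ (Fin 3))) :=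
    (integrable_indicator_iff hSm).2 hIR
  have hIFS : Integrable FS (volume : Measure (ℝ × EuclideanSpace ℝ (Fin 3))) :=
    (integrable_indicator_iff hSm).2 hIF'
  have hIWS : Integrable WS (volume : Measure (ℝ × EuclideanSpace ℝ (Fin 3))) :=
    (integrable_indicator_iff hSm).2 hIW
  -- ## the cut-offs `η k` with derivatives `ρ k`, at scale `δ k = T / (6 (k + 1))`
  set δ : ℕ → ℝ := fun k => T / (6 * ((k : ℝ) + 1)) with hδ
  have hδ0 : ∀ k, 0 < δ k := fun k => by positivity
  have hδT : ∀ k, 3 * δ k ≤ T := fun k => by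
    have hk : (0 : ℝ) ≤ k := Nat.cast_nonneg k
    have h1 : δ k ≤ T / 6 := by
      show T / (6 * ((k : ℝ) + 1)) ≤ T / 6
      exact div_le_div_of_nonneg_left hT.le (by norm_num) (by nlinarith)
    linarith
  have hδlim : Tendsto δ atTop (𝓝 0) := by
    have h1 : Tendsto (fun k : ℕ => (k : ℝ) + 1) atTop atTop :=
      tendsto_atTop_add_const_right _ 1 tendsto_natCast_atTop_atTop
    have h2 : Tendsto (fun k : ℕ => 6 * ((k : ℝ) + 1)) atTop atTop :=
      h1.const_mul_atTop (by norm_num)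
    exact tendsto_const_nhds.div_atTop h2
  obtain hcut : ∀ k, ∃ η ρ : ℝ → ℝ, ContDiff ℝ (⊤ : ℕ∞) η ∧ Continuous ρ ∧
      (∀ s, HasDerivAt η (ρ s) s) ∧ (∀ s, s ≤ δ k → η s = 0) ∧ (∀ s, 3 * δ k ≤ s → η s = 1) ∧
      (∀ s, η s ∈ Icc (0 : ℝ) 1) ∧ (∀ s, 0 ≤ ρ s) ∧ (∀ s, s ∉ Ioo (δ k) (3 * δ k) → ρ s = 0) ∧
      ∫ s, ρ s = 1 := fun k => exists_smooth_time_cutoff (hδ0 k)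
  choose η ρ hηs hρc hηρ hη0 hη1 hη01 hρ0 hρsupp hρ1 using hcut
  have hηabs : ∀ k (z : ℝ × EuclideanSpace ℝ (Fin 3)), ‖η k z.1‖ ≤ 1 := fun k z => by
    rw [Real.norm_eq_abs, abs_of_nonneg (hη01 k z.1).1]; exact (hη01 k z.1).2
  have hρC : ∀ k, ∃ C, 0 ≤ C ∧ ∀ s, |ρ k s| ≤ C := fun k =>
    exists_abs_le_of_eq_zero_off_Ioo (hρc k) (hρsupp k)
  have hηneg : ∀ k (s : ℝ), s ≤ 0 → η k s = 0 := fun k s hs => hη0 k s (hs.trans (hδ0 k).le)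
  have hρout : ∀ k (s : ℝ), s ∉ Ioo (0 : ℝ) T → ρ k s = 0 := by
    intro k s hs
    apply hρsupp
    intro h'
    exact hs ⟨(hδ0 k).trans h'.1, h'.2.trans_le (hδT k)⟩
  -- ## the structure's gradient and the inequality for each `k`
  obtain ⟨G₀, hG₀, hG₀2, hLEI⟩ := h.suitable.localEnergy
  have hGG : ∀ᵐ z ∂(volume : Measure (ℝ × EuclideanSpace ℝ (Fin 3))),
      z ∈ (Q : Set (ℝ × EuclideanSpace ℝ (Fin 3))) → uncurry G₀ z = uncurry G' z :=
    (ae_restrict_iff' Q.isOpen.measurableSet).1 (hG₀.ae_eq hG')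
  have hstep : ∀ k, 2 * ν * ∫ z, η k z.1 * FS z ≤ (∫ z, η k z.1 * RS z) + ∫ z, ρ k z.1 * WS z := by
    intro k
    -- the cut-off test function
    have hφk : IsSpaceTimeTestOn Q (fun s x => η k s * φ s x) :=
      hφ.cutoff (hδ0 k) (hηs k) (hη0 k)
    have hφk0 : ∀ t x, 0 ≤ η k t * φ t x := fun t x => mul_nonneg (hη01 k t).1 (hφ0 t x)
    have hL := hLEI _ hφk hφk0
    -- rewrite the right-hand integrand
    have hRk : ∀ t x, (‖v t x‖ ^ 2 * (timeDeriv (fun s x => η k s * φ s x) t x +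
          ν * Δ ((fun s x => η k s * φ s x) t) x) +
        (‖v t x‖ ^ 2 + 2 * π t x) * ⟪v t x, gradient ((fun s x => η k s * φ s x) t) x⟫ +
        2 * ⟪(0 : ℝ → EuclideanSpace ℝ (Fin 3) → EuclideanSpace ℝ (Fin 3)) t x, v t x⟫ *
          (fun s x => η k s * φ s x) t x) =
        η k t * R (t, x) + ρ k t * W (t, x) := by
      intro t x
      have e := localEnergyRHS_mul_of_hasDerivAt (ν := ν)
        (f := (0 : ℝ → EuclideanSpace ℝ (Fin 3) → EuclideanSpace ℝ (Fin 3))) (u := v) (p := π)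
        hφ (hηρ k) t x
      simp only [localEnergyRHS] at e
      simp only [hR, hW, localEnergyRHS]
      exact e
    simp_rw [hRk] at hL
    -- integrability of the three space–time integrands
    have hcw : Continuous fun z : ℝ × EuclideanSpace ℝ (Fin 3) => η k z.1 * φ z.1 z.2 :=
      hφk.contDiff.continuous
    have hwK : ∀ z ∉ tsupport (uncurry fun s x => η k s * φ s x), η k z.1 * φ z.1 z.2 = 0 :=
      fun z hz => show uncurry (fun s x => η k s * φ s x) z = 0 from
        image_eq_zero_of_notMem_tsupport hz
    have hIFk : Integrable (fun z : ℝ × EuclideanSpace ℝ (Fin 3) =>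
        frobeniusNormSq (G₀ z.1 z.2) * (η k z.1 * φ z.1 z.2)) volume :=
      integrable_mul_of_locallyIntegrableOn (locallyIntegrableOn_frobeniusNormSq hG₀ hG₀2) hcw
        hφk.hasCompactSupport hφk.tsupport_subset hwK
    obtain ⟨Cρ, -, hCρ⟩ := hρC k
    have hIηR : Integrable (fun z : ℝ × EuclideanSpace ℝ (Fin 3) => η k z.1 * RS z) volume :=
      hIRS.bdd_mul ((hηs k).continuous.comp continuous_fst).aestronglyMeasurable
        (Eventually.of_forall (hηabs k))
    have hIρW : Integrable (fun z : ℝ × EuclideanSpace ℝ (Fin 3) => ρ k z.1 * WS z) volume :=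
      hIWS.bdd_mul ((hρc k).comp continuous_fst).aestronglyMeasurable
        (Eventually.of_forall fun z => by rw [Real.norm_eq_abs]; exact hCρ z.1)
    -- pointwise identities off / on `S`
    have eR : ∀ z : ℝ × EuclideanSpace ℝ (Fin 3), η k z.1 * R z = η k z.1 * RS z := by
      intro z
      by_cases hz : z ∈ S
      · rw [hRS, indicator_of_mem hz]
      · rw [hRS, indicator_of_notMem hz, mul_zero]
        rcases le_or_gt z.1 0 with h0 | h0
        · rw [hηneg k z.1 h0, zero_mul]
        · have hT' : T ≤ z.1 := by
            by_contra hlt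
            exact hz ((hmemS z).2 ⟨h0, not_le.1 hlt⟩)
          rw [hR_T z hT', mul_zero]
    have eW : ∀ z : ℝ × EuclideanSpace ℝ (Fin 3), ρ k z.1 * W z = ρ k z.1 * WS z := by
      intro z
      by_cases hz : z ∈ S
      · rw [hWS, indicator_of_mem hz]
      · rw [hWS, indicator_of_notMem hz, mul_zero]
        rw [hρout k z.1 (fun h' => hz ((hmemS z).2 h')), zero_mul]
    have eF : (fun z : ℝ × EuclideanSpace ℝ (Fin 3) =>
        frobeniusNormSq (G₀ z.1 z.2) * (η k z.1 * φ z.1 z.2)) =ᵐ[volume]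
        fun z => η k z.1 * FS z := by
      filter_upwards [hGG] with z hz
      by_cases hzS : z ∈ S
      · have e1 : G₀ z.1 z.2 = G' z.1 z.2 := hz hzS
        rw [hFS, indicator_of_mem hzS, e1]
        simp only [hF']; ring
      · rw [hFS, indicator_of_notMem hzS, mul_zero]
        rcases le_or_gt z.1 0 with h0 | h0
        · rw [hηneg k z.1 h0, zero_mul, mul_zero]
        · have hT' : T ≤ z.1 := by
            by_contra hlt
            exact hzS ((hmemS z).2 ⟨h0, not_le.1 hlt⟩)
          rw [hφ_T z hT', mul_zero, mul_zero]
    -- both sides of `hL` as integrals over `ℝ × E`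
    have e1 : (∫ t, ∫ x, frobeniusNormSq (G₀ t x) * (η k t * φ t x)) = ∫ z, η k z.1 * FS z := by
      rw [← integral_congr_ae eF, Measure.volume_eq_prod, integral_prod _ hIFk]
    have hsum : Integrable (fun z : ℝ × EuclideanSpace ℝ (Fin 3) =>
        η k z.1 * R z + ρ k z.1 * W z) volume := by
      have : (fun z : ℝ × EuclideanSpace ℝ (Fin 3) => η k z.1 * R z + ρ k z.1 * W z) =
          fun z => η k z.1 * RS z + ρ k z.1 * WS z := by
        funext z; rw [eR z, eW z]
      rw [this]
      exact hIηR.add hIρW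
    have e2 : (∫ t, ∫ x, (η k t * R (t, x) + ρ k t * W (t, x))) =
        (∫ z, η k z.1 * RS z) + ∫ z, ρ k z.1 * WS z := by
      rw [← integral_add hIηR hIρW]
      have : (fun z : ℝ × EuclideanSpace ℝ (Fin 3) => η k z.1 * RS z + ρ k z.1 * WS z) =
          fun z => η k z.1 * R z + ρ k z.1 * W z := by
        funext z; rw [eR z, eW z]
      rw [this, Measure.volume_eq_prod, integral_prod _ hsum]
    rw [e1, e2] at hL
    exact hL
  -- ## the limits `k → ∞`
  have hlimη : ∀ H : ℝ × EuclideanSpace ℝ (Fin 3) → ℝ, Integrable H volume →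
      (∀ z : ℝ × EuclideanSpace ℝ (Fin 3), z.1 ≤ 0 → H z = 0) →
      Tendsto (fun k => ∫ z, η k z.1 * H z) atTop (𝓝 (∫ z, H z)) := by
    intro H hH hH0
    refine tendsto_integral_of_dominated_convergence (fun z => ‖H z‖)
      (fun k => (hH.bdd_mul ((hηs k).continuous.comp continuous_fst).aestronglyMeasurable
        (Eventually.of_forall (hηabs k))).aestronglyMeasurable)
      hH.norm (fun k => Eventually.of_forall fun z => ?_) (Eventually.of_forall fun z => ?_)
    · rw [norm_mul]
      exact mul_le_of_le_one_left (norm_nonneg _) (hηabs k z)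
    · rcases le_or_gt z.1 0 with h0 | h0
      · rw [hH0 z h0]
        simp only [mul_zero]
        exact tendsto_const_nhds
      · have hev : ∀ᶠ k in atTop, η k z.1 * H z = H z := by
          have h3 : Tendsto (fun k => 3 * δ k) atTop (𝓝 (3 * 0)) := hδlim.const_mul 3
          rw [mul_zero] at h3
          filter_upwards [(tendsto_order.1 h3).2 z.1 h0] with k hk
          rw [hη1 k z.1 hk.le, one_mul]
        exact tendsto_const_nhds.congr' (hev.mono fun k hk => hk.symm)
  have hS0 : ∀ {H : ℝ × EuclideanSpace ℝ (Fin 3) → ℝ} (z : ℝ × EuclideanSpace ℝ (Fin 3)),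
      z.1 ≤ 0 → S.indicator H z = 0 := fun z hz =>
    indicator_of_notMem (fun hzS => absurd ((hmemS z).1 hzS).1 (not_lt.2 hz)) _
  have hlimF : Tendsto (fun k => ∫ z, η k z.1 * FS z) atTop (𝓝 (∫ z, FS z)) :=
    hlimη FS hIFS fun z hz => hS0 z hz
  have hlimR : Tendsto (fun k => ∫ z, η k z.1 * RS z) atTop (𝓝 (∫ z, RS z)) :=
    hlimη RS hIRS fun z hz => hS0 z hz
  -- the initial term
  set U : ℝ → ℝ := fun t => ∫ x, WS (t, x) with hU
  set L : ℝ := ∫ x, ‖v₀ x‖ ^ 2 * φ 0 x with hL_def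
  have hIWS' : Integrable WS ((volume : Measure ℝ).prod (volume : Measure (EuclideanSpace ℝ (Fin 3)))) := by
    rw [← Measure.volume_eq_prod]; exact hIWS
  have hUint : Integrable U (volume : Measure ℝ) := hIWS'.integral_prod_left
  have hUeq : ∀ t ∈ Ioo (0 : ℝ) T, U t = ∫ x, ‖v t x‖ ^ 2 * φ t x := by
    intro t ht
    simp only [hU]
    refine integral_congr_ae (Eventually.of_forall fun x => ?_)
    show S.indicator W (t, x) = ‖v t x‖ ^ 2 * φ t x
    rw [indicator_of_mem ((hmemS (t, x)).2 ht)]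
  have hW3 : ∀ k, ∫ z, ρ k z.1 * WS z = ∫ t in Ioo 0 T, ρ k t * U t := by
    intro k
    obtain ⟨Cρ, -, hCρ⟩ := hρC k
    have hIρW : Integrable (fun z : ℝ × EuclideanSpace ℝ (Fin 3) => ρ k z.1 * WS z)
        ((volume : Measure ℝ).prod (volume : Measure (EuclideanSpace ℝ (Fin 3)))) :=
      hIWS'.bdd_mul ((hρc k).comp continuous_fst).aestronglyMeasurable
        (Eventually.of_forall fun z => by rw [Real.norm_eq_abs]; exact hCρ z.1)
    rw [Measure.volume_eq_prod, integral_prod _ hIρW]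
    have e1 : (fun t => ∫ x, ρ k (t, x).1 * WS (t, x)) = fun t => ρ k t * U t := by
      funext t
      simp only [hU, ← integral_const_mul]
    rw [e1]
    refine (setIntegral_eq_integral_of_forall_compl_eq_zero fun t ht => ?_).symm
    rw [hρout k t ht, zero_mul]
  have hlimW : Tendsto (fun k => ∫ z, ρ k z.1 * WS z) atTop (𝓝 L) := by
    simp_rw [hW3]
    refine tendsto_setIntegral_mul_of_ae_tendsto hUint.integrableOn ?_ hδlim hδ0 hδT hρc hρ0
      hρsupp hρ1
    intro ε hε
    obtain ⟨τ, hτ, hae⟩ := h.exists_ae_abs_integral_sq_mul_sub_datum_le hT hm₀ hφ' hφ0 hε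
    refine ⟨min τ T, lt_min hτ hT, ?_⟩
    have hae' := ae_restrict_of_ae_restrict_of_subset (Ioo_subset_Ioo_right (min_le_left τ T)) hae
    filter_upwards [hae', ae_restrict_mem measurableSet_Ioo] with t ht htI
    rw [hUeq t ⟨htI.1, htI.2.trans_le (min_le_right _ _)⟩]
    exact ht
  -- ## pass to the limit
  have hfinal : 2 * ν * ∫ z, FS z ≤ (∫ z, RS z) + L :=
    le_of_tendsto_of_tendsto' (hlimF.const_mul (2 * ν)) (hlimR.add hlimW) hstep
  -- back to set integrals, and from `G'` to `G`
  rw [hFS, hRS, integral_indicator hSm, integral_indicator hSm] at hfinal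
  have hGG' : ∀ᵐ z ∂(volume : Measure (ℝ × EuclideanSpace ℝ (Fin 3))),
      z ∈ (Q : Set (ℝ × EuclideanSpace ℝ (Fin 3))) → uncurry G z = uncurry G' z :=
    (ae_restrict_iff' Q.isOpen.measurableSet).1 (hG.ae_eq hG')
  have eG : ∫ z in S, frobeniusNormSq (G z.1 z.2) * φ z.1 z.2 = ∫ z in S, F' z := by
    refine setIntegral_congr_ae hSm ?_
    filter_upwards [hGG'] with z hz hzS
    have e1 : G z.1 z.2 = G' z.1 z.2 := hz hzS
    rw [e1]
  rw [eG]
  linarith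

end IsLocalLeraySolutionOn

end Literature.Analysis.FluidPDE
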